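import Summits.QuantumFields.BalabanUV.Beta.PropagatorWoodburyFibre

/-!
# GAN24 / DirichletExhaustionGaugeSplit — road P2, PART 21: Bałaban's SPLIT of a doubly-constrained covariance
# (constraint rows `Q` ⊕ gauge rows `S` with `Q H⁻¹ Sᴴ = 0`, `S H⁻¹ Sᴴ = 1`): the gauge border DECOUPLES, the fluctuation
# covariance is `flucCov H Q − H⁻¹SᴴSH⁻¹`, and the DECIMATED (two-level) blocks are gan24-p3's one-step objects over the
# effective form `effForm H Q₁` minus an explicit pure-gauge channel

Cell `pub-balaban`, β sub-cell, BINDER ROW **G-an2-4 ∕ (CONV-C)** — NOT IN PRINT; our proof attempt.  Lineage gan24-p2 (road P2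
«B4 §5 Dirichlet exhaustion with explicit rate»), gen 8; the file prefix is the lineage's reserved one (HOME/BETA/GAN24-NAMES.md § gan24-p2),
the content is the road-P2 seat's contribution to the S6 ∕ field-block dictionary of the K-slot (analysis note GAPS C-gan24p2-9,
`HOME/b2b-balaban-gan24-p2/gen8/KSLOT-FIELD-BLOCKS-PRINTED-SPLIT.md`).  HONEST FRAMING (verbatim): discharging `BetaPertH` makes
Bałaban's UV stability UNCONDITIONAL — a real constructive-QFT result; it is NOT the continuum limit and NOT the Clay problem.  HONEST
DEPENDENCY: continuum YM on T⁴ ⇐ BetaPertH ∧ nine spine estimates (0/9 proved); BetaPertH ⇐ (D1) ∧ (D4) ∧ CAP+tail; G-an2-4 gates asym,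
D1 and NE2/3/4.  ABSOLUTE RULE honoured: everything below is `[folklore]` finite-dimensional linear algebra over gan24-p3's `Matrix`
objects `pivot ∕ effForm ∕ minimiser ∕ flucCov ∕ comultiplier` (`Beta/PropagatorWoodburyFibre`, p200937-lineage); no `def`, no cited fact,
nothing printed is a hypothesis; the printed formulas named below are CONTEXT (what the abstract hypotheses are modelled on), not inputs.

## Why (context only).  After `GAN24/WoodburyFibreAssembly.convCKWall_iff_exists_fieldBlocksRate` the K-slot of the row is the
field-block residual (FF + FM blocks of the decimated one-step resolvent).  The typed one-shot system (`Beta/BlochFibreMatrix`) borders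
the Wilson form by the block-average rows `Q` AND by weak-gauge rows `S`; gan24-p3's census item (i) asks whether the composite gauge
condition factorises through the decimation or produces «an extra Schur correction from the gauge rows».  Bałaban's device
([Balaban1984PropagatorsI] (1.69)–(1.71), (1.93)–(1.97), (1.103), (1.107) pp. 29–35; [Balaban1985BackgroundPropagators] (3.152)–(3.153)
p. 426 — CONTEXT) is to border the auxiliary fine form `Δ_a = ∂*∂ + ∂R∂* + aQ*Q` instead: then there is a WITNESS `E` (there: `∂·Δ₀⁻¹↾_{ΔN(Q′)}`)
with `Δ_a E = Sᴴ`, `Q E = 0`, `S E = 1`, whence `Q Δ_a⁻¹ Sᴴ = 0` and `S Δ_a⁻¹ Sᴴ = 1` ((1.95), (1.97)), the `(Q ; S)`-capacitance is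
block-diagonal with identity gauge block, and the sharp covariance is `G − G∂R∂*G − GQ*(QGQ*)⁻¹QG` ((3.153)).  This file proves exactly
that mechanism ABSTRACTLY (any field with a star, any finite index types), in gan24-p3's currency, plus its DECIMATED form.

## What is proved (0 sorry; all `[folklore]`)
§1 witness ⇒ orthogonality: `inv_mul_conjTranspose_eq_of_witness` (`H⁻¹Sᴴ = E`), `orthQS_of_witness`, `orthSS_of_witness`,
   `orthSQ_of_orthQS` (Hermitian `H`), `gaugeTerm_eq_of_witness` (`H⁻¹SᴴSH⁻¹ = E Eᴴ` — the shape `G∂R∂*G = (∂G′R)(∂G′R)*`).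
§2 stacked rows `fromRows Q S` under `Q H⁻¹ Sᴴ = 0`, `S H⁻¹ Qᴴ = 0`, `S H⁻¹ Sᴴ = 1`: `pivot_fromRows` (general 2×2 block form),
   `pivot_fromRows_of_orth` (`= fromBlocks (pivot H Q) 0 0 1`), `isUnit_pivot_fromRows_of_orth`, `effForm_fromRows_of_orth`,
   **`flucCov_fromRows_of_orth`** (`flucCov H (fromRows Q S) = flucCov H Q − H⁻¹ * Sᴴ * S * H⁻¹`), `minimiser_fromRows_of_orth`
   (`= fromCols (minimiser H Q) (H⁻¹Sᴴ)`), `comultiplier_fromRows_of_orth`.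
§3 DECIMATED (two-level) forms — the K-slot shape, by gan24-p3's composition law `decimate_flucCov_comp ∕ decimate_minimiser_comp` BY NAME:
   **`decimate_flucCov_fromRows_comp`**: `Q₁ · flucCov H (fromRows (Q₂Q₁) S) · Q₁ᴴ = flucCov (effForm H Q₁) Q₂ − (Q₁H⁻¹Sᴴ)(SH⁻¹Q₁ᴴ)`,
   **`decimate_minimiser_fromRows_comp`**: `Q₁ · minimiser H (fromRows (Q₂Q₁) S) = fromCols (minimiser (effForm H Q₁) Q₂) (Q₁H⁻¹Sᴴ)`.
§4 (v1.1, APPEND-ONLY) Bałaban's auxiliary form ITSELF: for `H = K + SᴴS + a•QᴴQ` the witness hypothesis `H E = Sᴴ` of §1 FOLLOWS from the three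
   structural facts `K E = 0` (gauge invariance of the Wilson form along the witness directions), `S E = 1` (normalisation `R∂*·∂Δ₀⁻¹R = R`),
   `Q E = 0` ((1.55) `Q∂ = ∂₁Q′` on `N(Q′)`): `balabanForm_mul_witness`; whence `orthQS_balabanForm`, `orthSS_balabanForm` and the fully structural
   split **`flucCov_balabanForm_fromRows`** (`flucCov H (fromRows Q S) = flucCov H Q − E * Eᴴ`, `H` Hermitian-invertible, `IsUnit (pivot H Q)`).
NOT here: any instantiation on `BlochFibreMatrix` ∕ `KInvStep` (an2 ∕ an5's objects; their `FluctuationProjection.Cov`, `KKTFluctuationUnique`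
are the torus-side kernel statement and the uniqueness lever), any rate or decay, anything at `U ≠ 1`; NOT the K-slot, NOT BetaPertH, NOT
continuum, NOT Clay.
-/

namespace Summit.QuantumFields.BalabanUV.Beta.GAN24.DirichletExhaustionGaugeSplit

open Matrix
open Summit.QuantumFields.BalabanUV.Beta.PropagatorWoodburyFibre (pivot effForm minimiser flucCov comultiplier inv_effForm
  decimate_flucCov_comp decimate_minimiser_comp)

variable {𝕜 : Type*} [Field 𝕜] [StarRing 𝕜]
variable {l m n q : Type*} [Fintype l] [Fintype m] [Fintype n] [Fintype q]
variable [DecidableEq l] [DecidableEq m] [DecidableEq n] [DecidableEq q]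

/-! ## §1 A witness for the gauge rows gives Bałaban's orthogonality ((1.93)–(1.97) ∕ (3.152) abstractly) -/

omit [Fintype q] [DecidableEq q] in
/-- [folklore] If `H E = Sᴴ` for an invertible `H`, then `H⁻¹ Sᴴ = E` (the abstract form of «`G∂R = ∂G′R`», (3.152)). -/
theorem inv_mul_conjTranspose_eq_of_witness {H : Matrix n n 𝕜} (hH : IsUnit H) {S : Matrix q n 𝕜} {E : Matrix n q 𝕜}
    (hE : H * E = Sᴴ) : H⁻¹ * Sᴴ = E := by
  rw [← hE, ← Matrix.mul_assoc, nonsing_inv_mul _ ((isUnit_iff_isUnit_det _).mp hH), Matrix.one_mul]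

omit [Fintype m] [DecidableEq m] [Fintype q] [DecidableEq q] in
/-- [folklore] Witness with `Q E = 0` ⇒ `Q H⁻¹ Sᴴ = 0` (the abstract form of (1.95) «`QG∂R = 0`»). -/
theorem orthQS_of_witness {H : Matrix n n 𝕜} (hH : IsUnit H) {Q : Matrix m n 𝕜} {S : Matrix q n 𝕜} {E : Matrix n q 𝕜}
    (hE : H * E = Sᴴ) (hQE : Q * E = 0) : Q * H⁻¹ * Sᴴ = 0 := by
  rw [Matrix.mul_assoc, inv_mul_conjTranspose_eq_of_witness hH hE, hQE]

omit [Fintype q] in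
/-- [folklore] Witness with `S E = 1` ⇒ `S H⁻¹ Sᴴ = 1` (the abstract form of (1.97) «`R∂*G∂ = R`»). -/
theorem orthSS_of_witness {H : Matrix n n 𝕜} (hH : IsUnit H) {S : Matrix q n 𝕜} {E : Matrix n q 𝕜}
    (hE : H * E = Sᴴ) (hSE : S * E = 1) : S * H⁻¹ * Sᴴ = 1 := by
  rw [Matrix.mul_assoc, inv_mul_conjTranspose_eq_of_witness hH hE, hSE]

omit [Fintype m] [Fintype q] [DecidableEq m] [DecidableEq q] in
/-- [folklore] For Hermitian `H` the two mixed orthogonalities are equivalent: `Q H⁻¹ Sᴴ = 0 ⇒ S H⁻¹ Qᴴ = 0`. -/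
theorem orthSQ_of_orthQS {H : Matrix n n 𝕜} (hHh : H.IsHermitian) {Q : Matrix m n 𝕜} {S : Matrix q n 𝕜}
    (hQS : Q * H⁻¹ * Sᴴ = 0) : S * H⁻¹ * Qᴴ = 0 := by
  have h := congrArg conjTranspose hQS
  rwa [conjTranspose_mul, conjTranspose_mul, conjTranspose_conjTranspose, hHh.inv.eq, conjTranspose_zero,
    ← Matrix.mul_assoc] at h

omit [DecidableEq q] in
/-- [folklore] With a witness and Hermitian `H`, the gauge Schur term is the Gram matrix of the witness:
`H⁻¹ Sᴴ S H⁻¹ = E Eᴴ` (the shape `G∂R∂*G = ∂G′RG′∂*` of (3.153)). -/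
theorem gaugeTerm_eq_of_witness {H : Matrix n n 𝕜} (hH : IsUnit H) (hHh : H.IsHermitian) {S : Matrix q n 𝕜} {E : Matrix n q 𝕜}
    (hE : H * E = Sᴴ) : H⁻¹ * Sᴴ * S * H⁻¹ = E * Eᴴ := by
  have h1 : H⁻¹ * Sᴴ = E := inv_mul_conjTranspose_eq_of_witness hH hE
  have h2 : S * H⁻¹ = Eᴴ := by
    have := congrArg conjTranspose h1
    rwa [conjTranspose_mul, conjTranspose_conjTranspose, hHh.inv.eq] at this
  rw [Matrix.mul_assoc, h2, h1]

/-! ## §2 Stacked constraint rows `fromRows Q S` under Bałaban's orthogonality -/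

omit [Fintype m] [Fintype q] [DecidableEq m] [DecidableEq q] in
/-- [folklore] The pivot of stacked rows is the `2 × 2` block matrix of the four partial pivots. -/
theorem pivot_fromRows (H : Matrix n n 𝕜) (Q : Matrix m n 𝕜) (S : Matrix q n 𝕜) :
    pivot H (fromRows Q S) = fromBlocks (Q * H⁻¹ * Qᴴ) (Q * H⁻¹ * Sᴴ) (S * H⁻¹ * Qᴴ) (S * H⁻¹ * Sᴴ) := by
  rw [pivot, conjTranspose_fromRows_eq_fromCols_conjTranspose, fromRows_mul, fromRows_mul_fromCols]

omit [Fintype m] [Fintype q] [DecidableEq m] in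
/-- [folklore] Under the orthogonality the pivot is BLOCK-DIAGONAL with identity gauge block: `diag(pivot H Q, 1)`. -/
theorem pivot_fromRows_of_orth {H : Matrix n n 𝕜} {Q : Matrix m n 𝕜} {S : Matrix q n 𝕜}
    (hQS : Q * H⁻¹ * Sᴴ = 0) (hSQ : S * H⁻¹ * Qᴴ = 0) (hSS : S * H⁻¹ * Sᴴ = 1) :
    pivot H (fromRows Q S) = fromBlocks (pivot H Q) 0 0 1 := by
  rw [pivot_fromRows, hQS, hSQ, hSS, pivot]

/-- [folklore] The stacked pivot is invertible iff... — here: it IS invertible when `pivot H Q` is. -/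
theorem isUnit_pivot_fromRows_of_orth {H : Matrix n n 𝕜} {Q : Matrix m n 𝕜} {S : Matrix q n 𝕜} (hP : IsUnit (pivot H Q))
    (hQS : Q * H⁻¹ * Sᴴ = 0) (hSQ : S * H⁻¹ * Qᴴ = 0) (hSS : S * H⁻¹ * Sᴴ = 1) :
    IsUnit (pivot H (fromRows Q S)) := by
  rw [pivot_fromRows_of_orth hQS hSQ hSS]
  exact isUnit_fromBlocks_zero₂₁.mpr ⟨hP, isUnit_one⟩

/-- [folklore] The effective form of the stacked system: `diag(effForm H Q, 1)`. -/
theorem effForm_fromRows_of_orth {H : Matrix n n 𝕜} {Q : Matrix m n 𝕜} {S : Matrix q n 𝕜} (hP : IsUnit (pivot H Q))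
    (hQS : Q * H⁻¹ * Sᴴ = 0) (hSQ : S * H⁻¹ * Qᴴ = 0) (hSS : S * H⁻¹ * Sᴴ = 1) :
    effForm H (fromRows Q S) = fromBlocks (effForm H Q) 0 0 1 := by
  rw [effForm, pivot_fromRows_of_orth hQS hSQ hSS,
    inv_fromBlocks_zero₂₁_of_isUnit_iff _ _ _ (iff_of_true hP isUnit_one), effForm]
  simp only [Matrix.mul_zero, Matrix.zero_mul, neg_zero, inv_one]

/-- [folklore] **THE SPLIT**: with the gauge rows Bałaban-orthogonal, the doubly-constrained fluctuation covariance is the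
`Q`-constrained one MINUS the explicit gauge term: `flucCov H (Q ; S) = flucCov H Q − H⁻¹ Sᴴ S H⁻¹`
(the abstract (3.153): `𝔊 = G − GQ*(QGQ*)⁻¹QG − G∂R∂*G`). -/
theorem flucCov_fromRows_of_orth {H : Matrix n n 𝕜} {Q : Matrix m n 𝕜} {S : Matrix q n 𝕜} (hP : IsUnit (pivot H Q))
    (hQS : Q * H⁻¹ * Sᴴ = 0) (hSQ : S * H⁻¹ * Qᴴ = 0) (hSS : S * H⁻¹ * Sᴴ = 1) :
    flucCov H (fromRows Q S) = flucCov H Q - H⁻¹ * Sᴴ * S * H⁻¹ := by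
  rw [flucCov, effForm_fromRows_of_orth hP hQS hSQ hSS, conjTranspose_fromRows_eq_fromCols_conjTranspose, mul_fromCols,
    fromCols_mul_fromBlocks, Matrix.mul_zero, add_zero, Matrix.mul_zero, zero_add, Matrix.mul_one, fromCols_mul_fromRows,
    Matrix.add_mul, flucCov]
  simp only [Matrix.mul_assoc]
  abel

/-- [folklore] The minimiser of the stacked system: `fromCols (minimiser H Q) (H⁻¹Sᴴ)` (the gauge column is the witness, cf. §1). -/
theorem minimiser_fromRows_of_orth {H : Matrix n n 𝕜} {Q : Matrix m n 𝕜} {S : Matrix q n 𝕜} (hP : IsUnit (pivot H Q))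
    (hQS : Q * H⁻¹ * Sᴴ = 0) (hSQ : S * H⁻¹ * Qᴴ = 0) (hSS : S * H⁻¹ * Sᴴ = 1) :
    minimiser H (fromRows Q S) = fromCols (minimiser H Q) (H⁻¹ * Sᴴ) := by
  rw [minimiser, effForm_fromRows_of_orth hP hQS hSQ hSS, conjTranspose_fromRows_eq_fromCols_conjTranspose, mul_fromCols,
    fromCols_mul_fromBlocks, Matrix.mul_zero, add_zero, Matrix.mul_zero, zero_add, Matrix.mul_one, minimiser]

/-- [folklore] The multiplier row of the stacked system: `fromRows (comultiplier H Q) (S H⁻¹)`. -/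
theorem comultiplier_fromRows_of_orth {H : Matrix n n 𝕜} {Q : Matrix m n 𝕜} {S : Matrix q n 𝕜} (hP : IsUnit (pivot H Q))
    (hQS : Q * H⁻¹ * Sᴴ = 0) (hSQ : S * H⁻¹ * Qᴴ = 0) (hSS : S * H⁻¹ * Sᴴ = 1) :
    comultiplier H (fromRows Q S) = fromRows (comultiplier H Q) (S * H⁻¹) := by
  rw [comultiplier, effForm_fromRows_of_orth hP hQS hSQ hSS, fromBlocks_mul_fromRows, Matrix.zero_mul, add_zero,
    Matrix.zero_mul, zero_add, Matrix.one_mul, fromRows_mul, comultiplier]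

/-! ## §3 The DECIMATED (two-level) blocks — the K-slot shape -/

/-- [folklore] **DECIMATED FF BLOCK**: for a composite constraint `Q₂Q₁` and Bałaban-orthogonal gauge rows `S`, the `Q₁`-marginal of
the doubly-constrained covariance is gan24-p3's one-step covariance over the effective form of the first step MINUS the decimated
gauge channel: `Q₁·flucCov H (Q₂Q₁ ; S)·Q₁ᴴ = flucCov (effForm H Q₁) Q₂ − (Q₁H⁻¹Sᴴ)(SH⁻¹Q₁ᴴ)`. -/
theorem decimate_flucCov_fromRows_comp {H : Matrix n n 𝕜} {Q₁ : Matrix m n 𝕜} {Q₂ : Matrix l m 𝕜} {S : Matrix q n 𝕜}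
    (hP₁ : IsUnit (pivot H Q₁)) (hP : IsUnit (pivot H (Q₂ * Q₁)))
    (hQS : Q₂ * Q₁ * H⁻¹ * Sᴴ = 0) (hSQ : S * H⁻¹ * (Q₂ * Q₁)ᴴ = 0) (hSS : S * H⁻¹ * Sᴴ = 1) :
    Q₁ * flucCov H (fromRows (Q₂ * Q₁) S) * Q₁ᴴ = flucCov (effForm H Q₁) Q₂ - Q₁ * H⁻¹ * Sᴴ * (S * H⁻¹ * Q₁ᴴ) := by
  rw [flucCov_fromRows_of_orth hP hQS hSQ hSS, Matrix.mul_sub, Matrix.sub_mul, decimate_flucCov_comp hP₁]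
  simp only [Matrix.mul_assoc]

/-- [folklore] **DECIMATED FM BLOCK**: `Q₁·minimiser H (Q₂Q₁ ; S) = fromCols (minimiser (effForm H Q₁) Q₂) (Q₁H⁻¹Sᴴ)`. -/
theorem decimate_minimiser_fromRows_comp {H : Matrix n n 𝕜} {Q₁ : Matrix m n 𝕜} {Q₂ : Matrix l m 𝕜} {S : Matrix q n 𝕜}
    (hP₁ : IsUnit (pivot H Q₁)) (hP : IsUnit (pivot H (Q₂ * Q₁)))
    (hQS : Q₂ * Q₁ * H⁻¹ * Sᴴ = 0) (hSQ : S * H⁻¹ * (Q₂ * Q₁)ᴴ = 0) (hSS : S * H⁻¹ * Sᴴ = 1) :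
    Q₁ * minimiser H (fromRows (Q₂ * Q₁) S) = fromCols (minimiser (effForm H Q₁) Q₂) (Q₁ * H⁻¹ * Sᴴ) := by
  rw [minimiser_fromRows_of_orth hP hQS hSQ hSS, mul_fromCols, decimate_minimiser_comp hP₁, ← Matrix.mul_assoc]

/-! ## §4 (v1.1) Bałaban's auxiliary form `K + SᴴS + a•QᴴQ`: the witness hypothesis from structure -/

omit [DecidableEq m] [DecidableEq n] in
/-- [folklore] **Bałaban's auxiliary form produces the witness**: if `K E = 0` (the bare form is invariant along the witness directions),
`S E = 1` and `Q E = 0`, then `(K + SᴴS + a•QᴴQ) E = Sᴴ` — the abstract form of «`Δ_a ∂ν = ∂Δ₀ν` for `ν ∈ N(Q′)`» behind (1.93)–(1.97). -/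
theorem balabanForm_mul_witness (K : Matrix n n 𝕜) (Q : Matrix m n 𝕜) (S : Matrix q n 𝕜) (a : 𝕜) {E : Matrix n q 𝕜}
    (hKE : K * E = 0) (hSE : S * E = 1) (hQE : Q * E = 0) :
    (K + Sᴴ * S + a • (Qᴴ * Q)) * E = Sᴴ := by
  rw [Matrix.add_mul, Matrix.add_mul, hKE, zero_add, Matrix.mul_assoc, hSE, Matrix.mul_one, Matrix.smul_mul, Matrix.mul_assoc,
    hQE, Matrix.mul_zero, smul_zero, add_zero]

omit [DecidableEq m] in
/-- [folklore] (1.95) for Bałaban's auxiliary form, from structure: `Q (K + SᴴS + a•QᴴQ)⁻¹ Sᴴ = 0`. -/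
theorem orthQS_balabanForm {K : Matrix n n 𝕜} {Q : Matrix m n 𝕜} {S : Matrix q n 𝕜} {a : 𝕜} {E : Matrix n q 𝕜}
    (hH : IsUnit (K + Sᴴ * S + a • (Qᴴ * Q))) (hKE : K * E = 0) (hSE : S * E = 1) (hQE : Q * E = 0) :
    Q * (K + Sᴴ * S + a • (Qᴴ * Q))⁻¹ * Sᴴ = 0 :=
  orthQS_of_witness hH (balabanForm_mul_witness K Q S a hKE hSE hQE) hQE

omit [DecidableEq m] in
/-- [folklore] (1.97) for Bałaban's auxiliary form, from structure: `S (K + SᴴS + a•QᴴQ)⁻¹ Sᴴ = 1`. -/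
theorem orthSS_balabanForm {K : Matrix n n 𝕜} {Q : Matrix m n 𝕜} {S : Matrix q n 𝕜} {a : 𝕜} {E : Matrix n q 𝕜}
    (hH : IsUnit (K + Sᴴ * S + a • (Qᴴ * Q))) (hKE : K * E = 0) (hSE : S * E = 1) (hQE : Q * E = 0) :
    S * (K + Sᴴ * S + a • (Qᴴ * Q))⁻¹ * Sᴴ = 1 :=
  orthSS_of_witness hH (balabanForm_mul_witness K Q S a hKE hSE hQE) hSE

/-- [folklore] **THE FULLY STRUCTURAL SPLIT** (the abstract [B9] (3.153) with every hypothesis structural): for a Hermitian invertible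
`H = K + SᴴS + a•QᴴQ` with `IsUnit (pivot H Q)` and a witness `E` (`K E = 0`, `S E = 1`, `Q E = 0`):
`flucCov H (fromRows Q S) = flucCov H Q − E Eᴴ` (the sharp covariance = the `Q`-constrained one minus the explicit pure-gauge Gram term). -/
theorem flucCov_balabanForm_fromRows {K : Matrix n n 𝕜} {Q : Matrix m n 𝕜} {S : Matrix q n 𝕜} {a : 𝕜} {E : Matrix n q 𝕜}
    (hH : IsUnit (K + Sᴴ * S + a • (Qᴴ * Q))) (hHh : (K + Sᴴ * S + a • (Qᴴ * Q)).IsHermitian)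
    (hP : IsUnit (pivot (K + Sᴴ * S + a • (Qᴴ * Q)) Q)) (hKE : K * E = 0) (hSE : S * E = 1) (hQE : Q * E = 0) :
    flucCov (K + Sᴴ * S + a • (Qᴴ * Q)) (fromRows Q S) = flucCov (K + Sᴴ * S + a • (Qᴴ * Q)) Q - E * Eᴴ := by
  have hE := balabanForm_mul_witness K Q S a hKE hSE hQE
  have hQS := orthQS_of_witness hH hE hQE
  rw [flucCov_fromRows_of_orth hP hQS (orthSQ_of_orthQS hHh hQS) (orthSS_of_witness hH hE hSE), gaugeTerm_eq_of_witness hH hHh hE]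

end Summit.QuantumFields.BalabanUV.Beta.GAN24.DirichletExhaustionGaugeSplit
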